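import Summits.BirchSwinnertonDyer.BirchSwinnertonDyer.Theorems.GenusKolyvaginAtTwoPowDvdShaCardAtTwoRTInvariantLostBit
import HarnessLib

/-!
# Route `GenusKolyvaginAtTwo`, crux U_T `ShaCardDvdPowAtTwoRT` (stmt-BirchSwinnertonDyer-23298; upper half
# `#Ш(E/K)[2^∞] ∣ 2^(2M₀)`) — THE NORM-SHARP LAW OF A `τ`-INVARIANT PAIRING AT `2`: a `σ`-eigenvector pairs with an
# ARBITRARY element `x` of a free rank-one `ℤ/2^M[τ]`-module only through the NORM `x ± τx`; the order of the value is
# `2^(N_norm + N_y − M)` — McCallum's Lemma 5.3 at `p = 2` loses its bit exactly when the norm of the test class drops order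

Seat `bsd-line-gk2-p3` g25 (PROVER seat 3/3, cell `bsd-f1-sign2`), `--supports stmt-BirchSwinnertonDyer-23298` (helper; closes
nothing).  Mathlib-only algebra over this lineage's `…RTInvariantLostBit` (g23) and LEAD gk2-p1's `…RTEigenNorms`.  THEOREMS ONLY
(no definition, no named fact, no `sorry`).  BSD is NOT proved by any of this; neither is U_T, L_T, nor any stub.

WHY.  The UPPER half of Kolyvagin's structure theorem (McCallum 1991 Thm. 5.4: `N_{k+1} ≤ M_k − M_{k+1}`) certifies the order of
the Kolyvagin class `d_{M_k}(n_{k+1}) ∈ Ш(E/K)` from below by a NON-ZERO Cassels–Tate value, computed (Prop. 4.7) as ONE local Tate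
pairing `⟨d(n_{k+1})_λ, y_λ⟩_λ` at the new Kolyvagin place `λ = λ_{k+1}`, between the singular part of the Kolyvagin class (a
`τ`-EIGEN class `y` of sign `ε`, read modulo the Kummer condition) and the localisation `x = loc_λ c` of a lift `c` of a generator of
`Ш` (unramified, parametrised by the free rank-one `ℤ/2^M[τ]`-module `E[2^M]` on `Δ < 0`, route item Q1).  McCallum's Lemma 5.3
("same eigenspace and orders multiplying to more than `p^M` ⟹ non-trivial") is, at `p = 2`, the invariant lost-bit law of
`…RTInvariantLostBit` (`2^(N_x + N_y − (M+1))` for EIGEN `x`): one bit per rung, the live defect of U_T recorded in the cell's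
DEFECT-LEDGER-v1 (seat g14) and in the item's `why_might_fail`.  THIS FILE removes the hypothesis that `x` be an eigenvector and
shows where the bit really sits: writing `x = a·a₀ + b·τa₀`,

  `P(x, y) = (a + εb) · P(a₀, y)`   and   `x + ε τx = (a + εb) · (a₀ + ε τa₀)`,

so `P(·, y)` FACTORS THROUGH THE `ε`-NORM `x ↦ x + ετx` (§2), and **`addOrderOf P(x, y) = 2^(N_n + N_y − M)`** with
`2^{N_n} = addOrderOf (x + ετx)` (§3).  For an `ε`-eigenvector `x` the norm is `2x` (`N_n = N_x − 1`: the lost bit); for `x` of the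
opposite sign the norm is `0` (orthogonality, `…RTInvariantLostBit.pairing_eq_zero_of_opposite_signs`); for a GENERIC `x` (one whose
bottom bit `2^(N_x−1)x` is moved by `τ`) `N_n = N_x` and NO bit is lost.  §4 is the dual reading used by Kolyvagin's annihilation step:
`P(x, y) = 0 ⟹ 2^(M − N_y) · (x + ετx) = 0` — SHARP (the eigen-frame statement `2^(M − N_y + 1)·x = 0` is one bit weaker), whence
the global step-1 statement «`2^{M₀}·(1 + ε₁τ)·Sel_{2^M}(E/K) = 0`» of the seat's U_T memo (crux workfile
`Cruxes/ShaCardDvdPowAtTwoRT/Lines/norm-sharp-upper-gk2p3.md`).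

* §1 `addOrderOf_zsmul_eq_of_addOrderOf_zsmul_generator` — order bookkeeping WITHOUT the factor `2`: `g` of order `2^M`, `r` of order
  `2^{N_y} ≤ 2^M`, `a • g` of order `2^{N_n}` ⟹ `a • r` has order `2^(N_n + N_y − M)`.
* §2 `norm_eq_zsmul_norm_generator`, `conorm_eq_zsmul_conorm_generator`; `pairing_eq_zsmul_basis_of_fixed` / `_of_antifixed`;
  **`pairing_eq_of_norm_eq`** / **`pairing_eq_of_conorm_eq`** (`P(·, y)` factors through the norm).
* §3 **`normSharp_addOrderOf_pairing_of_fixed(_of_basis)`** / **`…_of_antifixed(_of_basis)`** and the thresholds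
  `pow_smul_pairing_eq_zero_iff_norm(_of_basis)` / `…_conorm(_of_basis)`.
* §4 **`two_pow_smul_norm_eq_zero_of_pairing_eq_zero(_of_basis)`** / **`…_conorm_…`** — sharp annihilation.

References: [McCallumLMS1991] §5 Lemma 5.3, proof of Thm. 5.4 (16)–(23), Thm. 5.8; [Kolyvagin1991MathAnn] Thm. 2.1; [GrossLMS1991] §8
Prop. 8.1–8.2, §10; [Howard2004HeegnerKolyvagin] Lemma 1.5.3.
-/

set_option autoImplicit false
-- `Summit.<P>.<Sub>` repeats `BirchSwinnertonDyer` by the tree's layout convention (D-0017)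
set_option linter.dupNamespace false

namespace Summit.BirchSwinnertonDyer.BirchSwinnertonDyer.Theorems.GenusExact.PlusDescent

/-! ## §1 Orders: the bookkeeping without the factor `2` -/

section Orders

variable {G R : Type*} [AddCommGroup G] [AddCommGroup R]

/-- **Order bookkeeping of the norm-sharp law.** `g` of order `2^M`, `r` of order `2^{N_y}` with `N_y ≤ M`, `a • g` of order
`2^{N_n}`: then `a • r` has order `2^(N_n + N_y − M)` (natural-number subtraction; the value is `0` exactly when `N_n + N_y ≤ M`).
Compare `addOrderOf_zsmul_two_nsmul_eq` (the same with `a • (2 • r)` and `M + 1`). [folklore] -/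
theorem addOrderOf_zsmul_eq_of_addOrderOf_zsmul_generator {M : ℕ} {g : G} (hg : addOrderOf g = 2 ^ M) {r : R} {Ny : ℕ}
    (hr : addOrderOf r = 2 ^ Ny) (hNyM : Ny ≤ M) (a : ℤ) {Nn : ℕ} (hNn : addOrderOf (a • g) = 2 ^ Nn) :
    addOrderOf (a • r) = 2 ^ (Nn + Ny - M) := by
  have hMr : ((2 ^ M : ℕ) : ℤ) • r = 0 := by
    rw [show ((2 ^ M : ℕ) : ℤ) = (2 ^ M : ℤ) by norm_cast]
    exact two_pow_zsmul_eq_zero_of_addOrderOf_eq hr hNyM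
  rcases zsmul_eq_zero_or_eq_two_pow_mul_odd_nsmul hg a with h0 | ⟨v, s, hv, hs, ha⟩
  · -- `a • g = 0`: then `2^M ∣ a`, `N_n = 0`, and `a • r = 0`
    rw [h0, addOrderOf_zero] at hNn
    have hNn0 : Nn = 0 := (eq_of_two_pow_eq_two_pow ((pow_zero 2).trans hNn)).symm
    have hdvd : ((addOrderOf g : ℕ) : ℤ) ∣ a - 0 := by
      rw [sub_zero]; exact (addOrderOf_dvd_iff_zsmul_eq_zero).mpr h0
    rw [hg] at hdvd
    have hzero : a • r = 0 := by rw [zsmul_eq_zsmul_of_dvd_sub hMr hdvd, zero_zsmul]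
    rw [hzero, addOrderOf_zero, hNn0]
    have : 0 + Ny - M = 0 := by omega
    rw [this, pow_zero]
  · -- `a • g = (2^v s) • g`, `v < M`, `s` odd: `N_n = M − v` and `a • r = (2^v s) • r`
    rw [ha, addOrderOf_two_pow_mul_odd_nsmul hg hv.le hs] at hNn
    have hNn' : Nn = M - v := (eq_of_two_pow_eq_two_pow hNn).symm
    have hdvd : ((addOrderOf g : ℕ) : ℤ) ∣ a - ((2 ^ v * s : ℕ) : ℤ) := by
      refine (addOrderOf_dvd_iff_zsmul_eq_zero).mpr ?_
      rw [sub_eq_add_neg, add_zsmul, neg_zsmul, natCast_zsmul, ← ha, add_neg_cancel]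
    rw [hg] at hdvd
    have hval : a • r = (2 ^ v * s) • r := by
      rw [zsmul_eq_zsmul_of_dvd_sub hMr hdvd, natCast_zsmul]
    rw [hval]
    by_cases hle : v ≤ Ny
    · rw [addOrderOf_two_pow_mul_odd_nsmul hr hle hs]
      congr 1
      omega
    · push Not at hle
      rw [(two_pow_mul_odd_nsmul_eq_zero_iff hr v s hs).mpr hle.le, addOrderOf_zero]
      have : Nn + Ny - M = 0 := by omega
      rw [this, pow_zero]

/-- The order of a `2^M`-torsion element is `2^N` for some `N ≤ M`. [folklore] -/
theorem exists_addOrderOf_eq_two_pow_of_zsmul_eq_zero {M : ℕ} {x : G} (hx : (2 ^ M : ℤ) • x = 0) :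
    ∃ N : ℕ, N ≤ M ∧ addOrderOf x = 2 ^ N := by
  have hdvd : addOrderOf x ∣ 2 ^ M := by
    rw [addOrderOf_dvd_iff_nsmul_eq_zero, ← natCast_zsmul]
    exact_mod_cast hx
  obtain ⟨N, hN, hxN⟩ := (Nat.dvd_prime_pow Nat.prime_two).mp hdvd
  exact ⟨N, hN, hxN⟩

end Orders

/-! ## §2 The pairing with an eigenvector factors through the norm -/

section Law

variable {A B R : Type*} [AddCommGroup A] [AddCommGroup B] [AddCommGroup R]
  (τ : A →+ A) (hτ : ∀ x, τ (τ x) = x) (σ : B →+ B) (hσ : ∀ y, σ (σ y) = y)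
  (P : A →+ B →+ R) (hinv : ∀ x y, P (τ x) (σ y) = P x y)
  {M : ℕ} (a₀ : A)
  (hspan : ∀ Q : A, ∃ a b : ℤ, Q = a • a₀ + b • τ a₀)
  (hfree : ∀ a b : ℤ, a • a₀ + b • τ a₀ = 0 → (2 ^ M : ℤ) ∣ a ∧ (2 ^ M : ℤ) ∣ b)
  (htor : (2 ^ M : ℤ) • a₀ = 0)
  (hnd : ∀ y : B, P a₀ y = 0 → P (τ a₀) y = 0 → y = 0)

include hτ in
/-- **The norm in coordinates**: `x + τx = (a + b) · (a₀ + τa₀)` for `x = a·a₀ + b·τa₀`. [folklore] -/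
theorem norm_eq_zsmul_norm_generator (a b : ℤ) :
    (a • a₀ + b • τ a₀) + τ (a • a₀ + b • τ a₀) = (a + b) • (a₀ + τ a₀) := by
  rw [map_add, map_zsmul, map_zsmul, hτ, add_zsmul, zsmul_add, zsmul_add]
  abel

include hτ in
/-- **The conorm in coordinates**: `x − τx = (a − b) · (a₀ − τa₀)` for `x = a·a₀ + b·τa₀`. [folklore] -/
theorem conorm_eq_zsmul_conorm_generator (a b : ℤ) :
    (a • a₀ + b • τ a₀) - τ (a • a₀ + b • τ a₀) = (a - b) • (a₀ - τ a₀) := by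
  rw [map_add, map_zsmul, map_zsmul, hτ, sub_zsmul, zsmul_sub, zsmul_sub]
  abel

include hσ hinv in
/-- **The value against a `σ`-FIXED `y` in coordinates**: `P(a·a₀ + b·τa₀, y) = (a + b) · P(a₀, y)` — the same coefficient `a + b`
as the norm. [cite: McCallumLMS1991, §5 Lemma 5.3] -/
theorem pairing_eq_zsmul_basis_of_fixed {y : B} (hy : σ y = y) (a b : ℤ) :
    P (a • a₀ + b • τ a₀) y = (a + b) • P a₀ y := by
  rw [map_add, map_zsmul, map_zsmul, AddMonoidHom.add_apply, AddMonoidHom.zsmul_apply, AddMonoidHom.zsmul_apply,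
    pairing_tau_left_of_fixed τ σ hσ P hinv hy, add_zsmul]

include hσ hinv in
/-- **The value against a `σ`-ANTI-FIXED `y` in coordinates**: `P(a·a₀ + b·τa₀, y) = (a − b) · P(a₀, y)` — the coefficient of the
conorm. [cite: McCallumLMS1991, §5 Lemma 5.3] -/
theorem pairing_eq_zsmul_basis_of_antifixed {y : B} (hy : σ y = -y) (a b : ℤ) :
    P (a • a₀ + b • τ a₀) y = (a - b) • P a₀ y := by
  rw [map_add, map_zsmul, map_zsmul, AddMonoidHom.add_apply, AddMonoidHom.zsmul_apply, AddMonoidHom.zsmul_apply,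
    pairing_tau_left_of_antifixed τ σ hσ P hinv hy, smul_neg, ← neg_zsmul, ← add_zsmul, ← sub_eq_add_neg]

include hτ hσ hinv hspan hfree htor in
/-- **`P(·, y)` FACTORS THROUGH THE NORM for `σ`-fixed `y`**: if `x + τx = x′ + τx′` then `P(x, y) = P(x′, y)`.  (In coordinates both
sides are `(a + b)·P(a₀, y)`, and `a + b` is determined modulo `2^M` by the norm; `2^M` kills `P(a₀, y)`.)  In particular `τx = −x`
gives `P(x, y) = P(0, y) = 0` (opposite signs orthogonal) and `τx = x` gives `P(x, y) = P`-of-norm-`2x` (the lost bit).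
[cite: McCallumLMS1991, §5 Lemma 5.3] [cite: Howard2004HeegnerKolyvagin, Lemma 1.5.3] -/
theorem pairing_eq_of_norm_eq {y : B} (hy : σ y = y) {x x' : A} (h : x + τ x = x' + τ x') : P x y = P x' y := by
  obtain ⟨a, b, rfl⟩ := hspan x
  obtain ⟨a', b', rfl⟩ := hspan x'
  rw [norm_eq_zsmul_norm_generator τ hτ a₀, norm_eq_zsmul_norm_generator τ hτ a₀] at h
  rw [pairing_eq_zsmul_basis_of_fixed τ σ hσ P hinv a₀ hy, pairing_eq_zsmul_basis_of_fixed τ σ hσ P hinv a₀ hy]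
  -- `(a + b) • n = (a' + b') • n` with `n` of order `2^M` ⟹ `2^M ∣ (a + b) − (a' + b')`
  have hdvd : ((2 ^ M : ℕ) : ℤ) ∣ (a + b) - (a' + b') := by
    rw [← addOrderOf_norm_eq τ a₀ hfree htor]
    exact (addOrderOf_dvd_iff_zsmul_eq_zero).mpr (by rw [sub_zsmul, h]; abel)
  have hMr : ((2 ^ M : ℕ) : ℤ) • P a₀ y = 0 := by
    rw [show ((2 ^ M : ℕ) : ℤ) = (2 ^ M : ℤ) by norm_cast]
    exact two_pow_zsmul_pairing_basis_eq_zero P a₀ htor y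
  exact zsmul_eq_zsmul_of_dvd_sub hMr hdvd

include hτ hσ hinv hspan hfree htor in
/-- **`P(·, y)` FACTORS THROUGH THE CONORM for `σ`-anti-fixed `y`**: if `x − τx = x′ − τx′` then `P(x, y) = P(x′, y)`.
[cite: McCallumLMS1991, §5 Lemma 5.3] [cite: Howard2004HeegnerKolyvagin, Lemma 1.5.3] -/
theorem pairing_eq_of_conorm_eq {y : B} (hy : σ y = -y) {x x' : A} (h : x - τ x = x' - τ x') : P x y = P x' y := by
  obtain ⟨a, b, rfl⟩ := hspan x
  obtain ⟨a', b', rfl⟩ := hspan x'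
  rw [conorm_eq_zsmul_conorm_generator τ hτ a₀, conorm_eq_zsmul_conorm_generator τ hτ a₀] at h
  rw [pairing_eq_zsmul_basis_of_antifixed τ σ hσ P hinv a₀ hy, pairing_eq_zsmul_basis_of_antifixed τ σ hσ P hinv a₀ hy]
  have hdvd : ((2 ^ M : ℕ) : ℤ) ∣ (a - b) - (a' - b') := by
    rw [← addOrderOf_conorm_eq τ a₀ hfree htor]
    exact (addOrderOf_dvd_iff_zsmul_eq_zero).mpr (by rw [sub_zsmul, h]; abel)
  have hMr : ((2 ^ M : ℕ) : ℤ) • P a₀ y = 0 := by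
    rw [show ((2 ^ M : ℕ) : ℤ) = (2 ^ M : ℤ) by norm_cast]
    exact two_pow_zsmul_pairing_basis_eq_zero P a₀ htor y
  exact zsmul_eq_zsmul_of_dvd_sub hMr hdvd

/-! ## §3 The norm-sharp order law -/

include hτ hσ hinv hspan hfree htor in
/-- **THE NORM-SHARP LAW (`σ`-fixed `y`, basis value displayed).**  `P : A × B → R` bi-additive with `P(τa, σb) = P(a, b)`, `A` free
of rank one over `ℤ/2^M[τ]` on `a₀`.  For ANY `x ∈ A` with `addOrderOf (x + τx) = 2^{N_n}` and a `σ`-fixed `y` with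
`addOrderOf P(a₀, y) = 2^{N_y}`:  **`addOrderOf P(x, y) = 2^(N_n + N_y − M)`**.  Eigen `x` (`τx = x`, order `2^{N_x}`): `x + τx = 2x`,
`N_n = N_x − 1`, recovering the invariant lost-bit law `2^(N_x + N_y − (M+1))`; generic `x`: `N_n = N_x`, NO bit lost.  At a deep
inert Kolyvagin place at `p = 2` (`A = E[2^M]` parametrising the unramified classes, `B ∋ y` the singular part of a Kolyvagin class):
the Cassels–Tate certificate of McCallum's Thm. 5.4 / 5.8 has the order of the NORM of the test class.
[cite: McCallumLMS1991, §5 Lemma 5.3 and proof of Thm. 5.4] [cite: Kolyvagin1991MathAnn, Thm. 2.1] -/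
theorem normSharp_addOrderOf_pairing_of_fixed_of_basis {x : A} {y : B} (hy : σ y = y)
    {Nn Ny : ℕ} (hNn : addOrderOf (x + τ x) = 2 ^ Nn) (hPy : addOrderOf (P a₀ y) = 2 ^ Ny) :
    addOrderOf (P x y) = 2 ^ (Nn + Ny - M) := by
  have hNyM : Ny ≤ M := exponent_pairing_basis_le P a₀ htor hPy
  obtain ⟨a, b, rfl⟩ := hspan x
  rw [norm_eq_zsmul_norm_generator τ hτ a₀] at hNn
  rw [pairing_eq_zsmul_basis_of_fixed τ σ hσ P hinv a₀ hy]
  exact addOrderOf_zsmul_eq_of_addOrderOf_zsmul_generator (addOrderOf_norm_eq τ a₀ hfree htor) hPy hNyM (a + b) hNn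

include hτ hσ hinv hspan hfree htor in
/-- **THE NORM-SHARP LAW (`σ`-anti-fixed `y`, basis value displayed)**: `addOrderOf (x − τx) = 2^{N_n}`, `σy = −y`,
`addOrderOf P(a₀, y) = 2^{N_y}` ⟹ **`addOrderOf P(x, y) = 2^(N_n + N_y − M)`**. [cite: McCallumLMS1991, §5 Lemma 5.3]
[cite: Kolyvagin1991MathAnn, Thm. 2.1] -/
theorem normSharp_addOrderOf_pairing_of_antifixed_of_basis {x : A} {y : B} (hy : σ y = -y)
    {Nn Ny : ℕ} (hNn : addOrderOf (x - τ x) = 2 ^ Nn) (hPy : addOrderOf (P a₀ y) = 2 ^ Ny) :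
    addOrderOf (P x y) = 2 ^ (Nn + Ny - M) := by
  have hNyM : Ny ≤ M := exponent_pairing_basis_le P a₀ htor hPy
  obtain ⟨a, b, rfl⟩ := hspan x
  rw [conorm_eq_zsmul_conorm_generator τ hτ a₀] at hNn
  rw [pairing_eq_zsmul_basis_of_antifixed τ σ hσ P hinv a₀ hy]
  exact addOrderOf_zsmul_eq_of_addOrderOf_zsmul_generator (addOrderOf_conorm_eq τ a₀ hfree htor) hPy hNyM (a - b) hNn

include hτ hσ hinv hspan hfree htor hnd in
/-- **THE NORM-SHARP LAW (`σ`-fixed `y`)**, with `P` right-non-degenerate against `a₀, τa₀` and the order of `y` itself: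
`addOrderOf (x + τx) = 2^{N_n}`, `σy = y`, `addOrderOf y = 2^{N_y}` ⟹ `addOrderOf P(x, y) = 2^(N_n + N_y − M)`.
[cite: McCallumLMS1991, §5 Lemma 5.3] -/
theorem normSharp_addOrderOf_pairing_of_fixed {x : A} {y : B} (hy : σ y = y)
    {Nn Ny : ℕ} (hNn : addOrderOf (x + τ x) = 2 ^ Nn) (hNy : addOrderOf y = 2 ^ Ny) :
    addOrderOf (P x y) = 2 ^ (Nn + Ny - M) :=
  normSharp_addOrderOf_pairing_of_fixed_of_basis τ hτ σ hσ P hinv a₀ hspan hfree htor hy hNn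
    (by rw [addOrderOf_pairing_basis_eq_of_eigen τ σ hσ P hinv a₀ hnd (Or.inl hy), hNy])

include hτ hσ hinv hspan hfree htor hnd in
/-- **THE NORM-SHARP LAW (`σ`-anti-fixed `y`)**: `addOrderOf (x − τx) = 2^{N_n}`, `σy = −y`, `addOrderOf y = 2^{N_y}` ⟹
`addOrderOf P(x, y) = 2^(N_n + N_y − M)`. [cite: McCallumLMS1991, §5 Lemma 5.3] -/
theorem normSharp_addOrderOf_pairing_of_antifixed {x : A} {y : B} (hy : σ y = -y)
    {Nn Ny : ℕ} (hNn : addOrderOf (x - τ x) = 2 ^ Nn) (hNy : addOrderOf y = 2 ^ Ny) :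
    addOrderOf (P x y) = 2 ^ (Nn + Ny - M) :=
  normSharp_addOrderOf_pairing_of_antifixed_of_basis τ hτ σ hσ P hinv a₀ hspan hfree htor hy hNn
    (by rw [addOrderOf_pairing_basis_eq_of_eigen τ σ hσ P hinv a₀ hnd (Or.inr hy), hNy])

include hτ hσ hinv hspan hfree htor in
/-- **Threshold form (`σ`-fixed `y`, basis displayed)**: `2^j • P(x, y) = 0 ⟺ N_n + N_y ≤ M + j`.  With `j = 0`: the value is
non-zero iff `N_n + N_y > M` — the informativeness guard of McCallum's certificate at `2`, read on the NORM. [cite: McCallumLMS1991,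
§5 proof of Thm. 5.4] -/
theorem pow_smul_pairing_eq_zero_iff_norm_of_basis {x : A} {y : B} (hy : σ y = y)
    {Nn Ny : ℕ} (hNn : addOrderOf (x + τ x) = 2 ^ Nn) (hPy : addOrderOf (P a₀ y) = 2 ^ Ny) (j : ℕ) :
    (2 ^ j) • P x y = 0 ↔ Nn + Ny ≤ M + j := by
  rw [← addOrderOf_dvd_iff_nsmul_eq_zero,
    normSharp_addOrderOf_pairing_of_fixed_of_basis τ hτ σ hσ P hinv a₀ hspan hfree htor hy hNn hPy,
    Nat.pow_dvd_pow_iff_le_right one_lt_two]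
  omega

include hτ hσ hinv hspan hfree htor in
/-- **Threshold form (`σ`-anti-fixed `y`, basis displayed)**: `2^j • P(x, y) = 0 ⟺ N_n + N_y ≤ M + j` with `2^{N_n}` the order
of the conorm `x − τx`. [cite: McCallumLMS1991, §5 proof of Thm. 5.4] -/
theorem pow_smul_pairing_eq_zero_iff_conorm_of_basis {x : A} {y : B} (hy : σ y = -y)
    {Nn Ny : ℕ} (hNn : addOrderOf (x - τ x) = 2 ^ Nn) (hPy : addOrderOf (P a₀ y) = 2 ^ Ny) (j : ℕ) :
    (2 ^ j) • P x y = 0 ↔ Nn + Ny ≤ M + j := by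
  rw [← addOrderOf_dvd_iff_nsmul_eq_zero,
    normSharp_addOrderOf_pairing_of_antifixed_of_basis τ hτ σ hσ P hinv a₀ hspan hfree htor hy hNn hPy,
    Nat.pow_dvd_pow_iff_le_right one_lt_two]
  omega

include hτ hσ hinv hspan hfree htor in
/-- **Non-vanishing form (`σ`-fixed `y`)**: `N_n + N_y ≥ M + 1 ⟹ P(x, y) ≠ 0` — one bit EARLIER than the eigen-frame guard
`N_x + N_y ≥ M + 2` whenever the norm of `x` has full order. [cite: McCallumLMS1991, §5 proof of Thm. 5.4] -/
theorem pairing_ne_zero_of_norm {x : A} {y : B} (hy : σ y = y)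
    {Nn Ny : ℕ} (hNn : addOrderOf (x + τ x) = 2 ^ Nn) (hPy : addOrderOf (P a₀ y) = 2 ^ Ny) (h : M + 1 ≤ Nn + Ny) :
    P x y ≠ 0 := by
  intro h0
  have h1 : (2 ^ 0) • P x y = 0 := by rw [h0, smul_zero]
  have := (pow_smul_pairing_eq_zero_iff_norm_of_basis τ hτ σ hσ P hinv a₀ hspan hfree htor hy hNn hPy 0).mp h1
  omega

include hτ hσ hinv hspan hfree htor in
/-- **Non-vanishing form (`σ`-anti-fixed `y`)**: `N_n + N_y ≥ M + 1 ⟹ P(x, y) ≠ 0`, `2^{N_n}` the order of `x − τx`.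
[cite: McCallumLMS1991, §5 proof of Thm. 5.4] -/
theorem pairing_ne_zero_of_conorm {x : A} {y : B} (hy : σ y = -y)
    {Nn Ny : ℕ} (hNn : addOrderOf (x - τ x) = 2 ^ Nn) (hPy : addOrderOf (P a₀ y) = 2 ^ Ny) (h : M + 1 ≤ Nn + Ny) :
    P x y ≠ 0 := by
  intro h0
  have h1 : (2 ^ 0) • P x y = 0 := by rw [h0, smul_zero]
  have := (pow_smul_pairing_eq_zero_iff_conorm_of_basis τ hτ σ hσ P hinv a₀ hspan hfree htor hy hNn hPy 0).mp h1
  omega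

/-! ## §4 The dual reading: sharp annihilation -/

include htor in
/-- Every element of `A` is `2^M`-torsion (so its norm has order `2^N` with `N ≤ M`). [folklore] -/
theorem two_pow_zsmul_eq_zero_of_mem_span {x : A} (hx : ∃ a b : ℤ, x = a • a₀ + b • τ a₀) : (2 ^ M : ℤ) • x = 0 := by
  obtain ⟨a, b, rfl⟩ := hx
  rw [zsmul_add, smul_smul, smul_smul, mul_comm, ← smul_smul, htor, smul_zero, zero_add, mul_comm, ← smul_smul,
    ← map_zsmul, htor, map_zero, smul_zero]

include hτ hσ hinv hspan hfree htor in
/-- **SHARP ANNIHILATION (`σ`-fixed `y`, basis displayed).**  If `P(x, y) = 0` for a `σ`-fixed `y` with `addOrderOf P(a₀, y) = 2^{N_y}`,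
then **`2^(M − N_y) • (x + τx) = 0`**.  Kolyvagin's duality step at `2` (McCallum §5 (13), Gross Prop. 8.2) for an ARBITRARY Selmer
class `s`: `⟨loc_λ s, [c(n)_λ]_s⟩_λ = 0` with the singular part of exact order `2^(M − a)` modulo the Kummer condition forces
`2^a · (1 + τ)·loc_λ s = 0` — for an eigenclass this is the familiar `2^(a+1)·loc_λ s = 0`, one bit weaker.
[cite: McCallumLMS1991, §5 (13)] [cite: GrossLMS1991, §8 Prop. 8.2, §10] -/
theorem two_pow_smul_norm_eq_zero_of_pairing_eq_zero_of_basis {x : A} {y : B} (hy : σ y = y)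
    {Ny : ℕ} (hPy : addOrderOf (P a₀ y) = 2 ^ Ny) (h0 : P x y = 0) :
    (2 ^ (M - Ny)) • (x + τ x) = 0 := by
  have hx2 : (2 ^ M : ℤ) • (x + τ x) = 0 := by
    rw [zsmul_add, ← map_zsmul, two_pow_zsmul_eq_zero_of_mem_span τ a₀ htor (hspan x), map_zero, add_zero]
  obtain ⟨Nn, -, hNn⟩ := exists_addOrderOf_eq_two_pow_of_zsmul_eq_zero hx2
  have hle : Nn + Ny ≤ M + 0 := by
    refine (pow_smul_pairing_eq_zero_iff_norm_of_basis τ hτ σ hσ P hinv a₀ hspan hfree htor hy hNn hPy 0).mp ?_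
    rw [h0, smul_zero]
  rw [← addOrderOf_dvd_iff_nsmul_eq_zero, hNn]
  exact pow_dvd_pow 2 (by omega)

include hτ hσ hinv hspan hfree htor in
/-- **SHARP ANNIHILATION (`σ`-anti-fixed `y`, basis displayed)**: `P(x, y) = 0`, `σy = −y`, `addOrderOf P(a₀, y) = 2^{N_y}` ⟹
**`2^(M − N_y) • (x − τx) = 0`**. [cite: McCallumLMS1991, §5 (13)] [cite: GrossLMS1991, §8 Prop. 8.2, §10] -/
theorem two_pow_smul_conorm_eq_zero_of_pairing_eq_zero_of_basis {x : A} {y : B} (hy : σ y = -y)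
    {Ny : ℕ} (hPy : addOrderOf (P a₀ y) = 2 ^ Ny) (h0 : P x y = 0) :
    (2 ^ (M - Ny)) • (x - τ x) = 0 := by
  have hx2 : (2 ^ M : ℤ) • (x - τ x) = 0 := by
    rw [zsmul_sub, ← map_zsmul, two_pow_zsmul_eq_zero_of_mem_span τ a₀ htor (hspan x), map_zero, sub_zero]
  obtain ⟨Nn, -, hNn⟩ := exists_addOrderOf_eq_two_pow_of_zsmul_eq_zero hx2
  have hle : Nn + Ny ≤ M + 0 := by
    refine (pow_smul_pairing_eq_zero_iff_conorm_of_basis τ hτ σ hσ P hinv a₀ hspan hfree htor hy hNn hPy 0).mp ?_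
    rw [h0, smul_zero]
  rw [← addOrderOf_dvd_iff_nsmul_eq_zero, hNn]
  exact pow_dvd_pow 2 (by omega)

include hτ hσ hinv hspan hfree htor hnd in
/-- **SHARP ANNIHILATION (`σ`-fixed `y`)** with the order of `y` itself (`P` right-non-degenerate against `a₀, τa₀`):
`P(x, y) = 0`, `σy = y`, `addOrderOf y = 2^{N_y}` ⟹ `2^(M − N_y) • (x + τx) = 0`. [cite: McCallumLMS1991, §5 (13)]
[cite: GrossLMS1991, §8 Prop. 8.2] -/
theorem two_pow_smul_norm_eq_zero_of_pairing_eq_zero {x : A} {y : B} (hy : σ y = y)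
    {Ny : ℕ} (hNy : addOrderOf y = 2 ^ Ny) (h0 : P x y = 0) : (2 ^ (M - Ny)) • (x + τ x) = 0 :=
  two_pow_smul_norm_eq_zero_of_pairing_eq_zero_of_basis τ hτ σ hσ P hinv a₀ hspan hfree htor hy
    (by rw [addOrderOf_pairing_basis_eq_of_eigen τ σ hσ P hinv a₀ hnd (Or.inl hy), hNy]) h0

include hτ hσ hinv hspan hfree htor hnd in
/-- **SHARP ANNIHILATION (`σ`-anti-fixed `y`)** with the order of `y` itself: `P(x, y) = 0`, `σy = −y`, `addOrderOf y = 2^{N_y}` ⟹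
`2^(M − N_y) • (x − τx) = 0`. [cite: McCallumLMS1991, §5 (13)] [cite: GrossLMS1991, §8 Prop. 8.2] -/
theorem two_pow_smul_conorm_eq_zero_of_pairing_eq_zero {x : A} {y : B} (hy : σ y = -y)
    {Ny : ℕ} (hNy : addOrderOf y = 2 ^ Ny) (h0 : P x y = 0) : (2 ^ (M - Ny)) • (x - τ x) = 0 :=
  two_pow_smul_conorm_eq_zero_of_pairing_eq_zero_of_basis τ hτ σ hσ P hinv a₀ hspan hfree htor hy
    (by rw [addOrderOf_pairing_basis_eq_of_eigen τ σ hσ P hinv a₀ hnd (Or.inr hy), hNy]) h0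

/-- **Where the bit sits.** For any `x ∈ A` and `N`: `2^(N−1) • (x + τx) = 0 ⟺ τ(2^(N−1) • x) = −(2^(N−1) • x)` and
`2^(N−1) • (x − τx) = 0 ⟺ τ(2^(N−1) • x) = 2^(N−1) • x`.  Read for `x` of order `2^N`, `N ≥ 1`: the norm `x + τx` (resp. the conorm
`x − τx`) keeps the FULL order `2^N` iff the bottom bit `2^(N−1) • x ∈ A[2]` is not `τ`-anti-fixed (resp. not `τ`-fixed); on `A[2]`
the two signs coincide, so an element whose bottom bit is `τ`-MOVED keeps both norms at full order (no bit lost against either sign),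
while a `τ`-fixed bottom bit costs exactly the lost bit of McCallum's Lemma 5.3 at `2`. [folklore] -/
theorem two_pow_smul_norm_eq_zero_iff (x : A) (N : ℕ) :
    ((2 ^ (N - 1)) • (x + τ x) = 0 ↔ τ ((2 ^ (N - 1)) • x) = -((2 ^ (N - 1)) • x)) ∧
      ((2 ^ (N - 1)) • (x - τ x) = 0 ↔ τ ((2 ^ (N - 1)) • x) = (2 ^ (N - 1)) • x) := by
  constructor
  · rw [smul_add, ← map_nsmul, add_comm, add_eq_zero_iff_eq_neg]
  · rw [smul_sub, ← map_nsmul, sub_eq_zero, eq_comm]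

end Law

end Summit.BirchSwinnertonDyer.BirchSwinnertonDyer.Theorems.GenusExact.PlusDescent
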